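import Summits.QuantumFields.YangMills.Theorems.ColdStartUniversalityColdStartSolutionsExistVecPicard
import Summits.QuantumFields.YangMills.Theorems.ColdStartUniversalityColdStartSolutionsExistAmbientQuaternion
import Summits.QuantumFields.YangMills.Theorems.ColdStartUniversalityColdStartSolutionsExistFlatFiltration
import Summits.QuantumFields.YangMills.Theorems.ColdStartUniversalityColdStartSolutionsExistProgressive
import HarnessLib

/-!
# Route `ColdStartUniversality`, support item S (stmt-QuantumFields-24811), line `piwiener`:
# stub A — ambient strong existence for tame link SDEs, `V`-valued, via quaternion coordinates

Helper file (lead `ym-line-csu-p1`).  For a link SDE `S` on `M₂(ℂ)^E` which is TAME (squared-Frobenius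
Lipschitz drift and noise, coefficients mapping `V^E` to `V`, `V = span_ℝ SU(2)`), on ANY probability space
with a flat Brownian motion `W` (joint raw filtration), and every `Q₀ ∈ V^E`, there is an ambient strong
solution `X` (adapted, entrywise progressive, a.s. continuous, `L²(sup)`, `X 0 = Q₀`, entrywise Itô
equations with the tree's `IsItoIntegralC`) which is `V`-valued SURELY: run the vector Picard theorem
`exists_vecSDE_solution` (`…VecPicard`) in the real quaternion coordinates `(Re Q₀₀, Im Q₀₀, Re Q₀₁, Im Q₀₁)`
per link (`…AmbientQuaternion`) and map back by `q(a,b,c,d) = !![a+bi, c+di; −c+di, a−bi]`.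

* `quatCoord_lipschitz` — the real coordinates of a squared-Frobenius-Lipschitz coefficient are
  sum-of-squares Lipschitz in the quaternion coordinates;
* `hsForm_quatConfig_sum`, `continuous_quatConfig`, `measurable_quatConfig`,
  `isStronglyProgressive_quatConfig` — bookkeeping for configurations of quaternion matrices.

No definition, no sorry.  RECORD-rung plumbing; nothing here bears on the Yang–Mills mass gap. -/

set_option autoImplicit false

noncomputable section

namespace Summit.QuantumFields.YangMills.Theorems.ColdStartUniversality

open MeasureTheory ProbabilityTheory Filter Topology Finset Matrix Complex
open scoped NNReal ENNReal BigOperators ComplexConjugate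
open Literature.Probability.Process Literature.Analysis.FunctionSpaces
open Literature.MathematicalPhysics.QuantumFieldTheory
open Literature.MathematicalPhysics.QuantumLattice (fundamentalRep)

section Coordinates

variable {L : ℕ} [NeZero L]

/-- **Quaternion coordinates of a tame coefficient are Lipschitz**: for `F : M₂(ℂ)^E → M₂(ℂ)` with
`‖F Q − F Q'‖_F² ≤ K Σ_e ‖Q_e − Q'_e‖_F²` (`K ≥ 0`), the four real coordinates
`(Re F₀₀, Im F₀₀, Re F₀₁, Im F₀₁)` read along the quaternion parametrisation `y ↦ (q(y_e))_e` satisfy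
`Σ_a (coord_a(y) − coord_a(y'))² ≤ 2K Σ_p (y_p − y'_p)²`. [folklore] -/
theorem quatCoord_lipschitz {F : MatrixConfig 3 L 2 → Matrix (Fin 2) (Fin 2) ℂ} {K : ℝ}
    (hF : ∀ Q Q' : MatrixConfig 3 L 2,
      hsForm 2 (F Q - F Q') (F Q - F Q') ≤ K * ∑ e', hsForm 2 (Q e' - Q' e') (Q e' - Q' e'))
    (y y' : Edge 3 L × Fin 4 → ℝ) :
    ∑ a : Fin 4,
      (![(F (fun e => !![((y (e, 0) : ℝ) : ℂ) + ((y (e, 1) : ℝ) : ℂ) * Complex.I,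
            ((y (e, 2) : ℝ) : ℂ) + ((y (e, 3) : ℝ) : ℂ) * Complex.I;
            -((y (e, 2) : ℝ) : ℂ) + ((y (e, 3) : ℝ) : ℂ) * Complex.I,
            ((y (e, 0) : ℝ) : ℂ) - ((y (e, 1) : ℝ) : ℂ) * Complex.I]) 0 0).re,
          (F (fun e => !![((y (e, 0) : ℝ) : ℂ) + ((y (e, 1) : ℝ) : ℂ) * Complex.I,
            ((y (e, 2) : ℝ) : ℂ) + ((y (e, 3) : ℝ) : ℂ) * Complex.I;
            -((y (e, 2) : ℝ) : ℂ) + ((y (e, 3) : ℝ) : ℂ) * Complex.I,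
            ((y (e, 0) : ℝ) : ℂ) - ((y (e, 1) : ℝ) : ℂ) * Complex.I]) 0 0).im,
          (F (fun e => !![((y (e, 0) : ℝ) : ℂ) + ((y (e, 1) : ℝ) : ℂ) * Complex.I,
            ((y (e, 2) : ℝ) : ℂ) + ((y (e, 3) : ℝ) : ℂ) * Complex.I;
            -((y (e, 2) : ℝ) : ℂ) + ((y (e, 3) : ℝ) : ℂ) * Complex.I,
            ((y (e, 0) : ℝ) : ℂ) - ((y (e, 1) : ℝ) : ℂ) * Complex.I]) 0 1).re,
          (F (fun e => !![((y (e, 0) : ℝ) : ℂ) + ((y (e, 1) : ℝ) : ℂ) * Complex.I,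
            ((y (e, 2) : ℝ) : ℂ) + ((y (e, 3) : ℝ) : ℂ) * Complex.I;
            -((y (e, 2) : ℝ) : ℂ) + ((y (e, 3) : ℝ) : ℂ) * Complex.I,
            ((y (e, 0) : ℝ) : ℂ) - ((y (e, 1) : ℝ) : ℂ) * Complex.I]) 0 1).im] a -
        ![(F (fun e => !![((y' (e, 0) : ℝ) : ℂ) + ((y' (e, 1) : ℝ) : ℂ) * Complex.I,
            ((y' (e, 2) : ℝ) : ℂ) + ((y' (e, 3) : ℝ) : ℂ) * Complex.I;
            -((y' (e, 2) : ℝ) : ℂ) + ((y' (e, 3) : ℝ) : ℂ) * Complex.I,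
            ((y' (e, 0) : ℝ) : ℂ) - ((y' (e, 1) : ℝ) : ℂ) * Complex.I]) 0 0).re,
          (F (fun e => !![((y' (e, 0) : ℝ) : ℂ) + ((y' (e, 1) : ℝ) : ℂ) * Complex.I,
            ((y' (e, 2) : ℝ) : ℂ) + ((y' (e, 3) : ℝ) : ℂ) * Complex.I;
            -((y' (e, 2) : ℝ) : ℂ) + ((y' (e, 3) : ℝ) : ℂ) * Complex.I,
            ((y' (e, 0) : ℝ) : ℂ) - ((y' (e, 1) : ℝ) : ℂ) * Complex.I]) 0 0).im,
          (F (fun e => !![((y' (e, 0) : ℝ) : ℂ) + ((y' (e, 1) : ℝ) : ℂ) * Complex.I,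
            ((y' (e, 2) : ℝ) : ℂ) + ((y' (e, 3) : ℝ) : ℂ) * Complex.I;
            -((y' (e, 2) : ℝ) : ℂ) + ((y' (e, 3) : ℝ) : ℂ) * Complex.I,
            ((y' (e, 0) : ℝ) : ℂ) - ((y' (e, 1) : ℝ) : ℂ) * Complex.I]) 0 1).re,
          (F (fun e => !![((y' (e, 0) : ℝ) : ℂ) + ((y' (e, 1) : ℝ) : ℂ) * Complex.I,
            ((y' (e, 2) : ℝ) : ℂ) + ((y' (e, 3) : ℝ) : ℂ) * Complex.I;
            -((y' (e, 2) : ℝ) : ℂ) + ((y' (e, 3) : ℝ) : ℂ) * Complex.I,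
            ((y' (e, 0) : ℝ) : ℂ) - ((y' (e, 1) : ℝ) : ℂ) * Complex.I]) 0 1).im] a) ^ 2 ≤
      2 * K * ∑ p, (y p - y' p) ^ 2 := by
  -- abbreviate
  set Q : MatrixConfig 3 L 2 := fun e => !![((y (e, 0) : ℝ) : ℂ) + ((y (e, 1) : ℝ) : ℂ) * Complex.I,
    ((y (e, 2) : ℝ) : ℂ) + ((y (e, 3) : ℝ) : ℂ) * Complex.I;
    -((y (e, 2) : ℝ) : ℂ) + ((y (e, 3) : ℝ) : ℂ) * Complex.I, ((y (e, 0) : ℝ) : ℂ) - ((y (e, 1) : ℝ) : ℂ) * Complex.I]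
    with hQ
  set Q' : MatrixConfig 3 L 2 := fun e => !![((y' (e, 0) : ℝ) : ℂ) + ((y' (e, 1) : ℝ) : ℂ) * Complex.I,
    ((y' (e, 2) : ℝ) : ℂ) + ((y' (e, 3) : ℝ) : ℂ) * Complex.I;
    -((y' (e, 2) : ℝ) : ℂ) + ((y' (e, 3) : ℝ) : ℂ) * Complex.I, ((y' (e, 0) : ℝ) : ℂ) - ((y' (e, 1) : ℝ) : ℂ) * Complex.I]
    with hQ'
  have hdiff : ∀ e', hsForm 2 (Q e' - Q' e') (Q e' - Q' e') =
      2 * ((y (e', 0) - y' (e', 0)) ^ 2 + (y (e', 1) - y' (e', 1)) ^ 2 + (y (e', 2) - y' (e', 2)) ^ 2 +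
        (y (e', 3) - y' (e', 3)) ^ 2) := by
    intro e'
    simp only [hQ, hQ']
    rw [quat_sub, hsForm_quat]
  have hsum : ∑ e', hsForm 2 (Q e' - Q' e') (Q e' - Q' e') = 2 * ∑ p, (y p - y' p) ^ 2 := by
    rw [Fintype.sum_prod_type (fun p : Edge 3 L × Fin 4 => (y p - y' p) ^ 2), Finset.mul_sum]
    refine Finset.sum_congr rfl fun e' _ => ?_
    rw [hdiff e', Fin.sum_univ_four]
  have hcoord : ∑ a : Fin 4, (![(F Q 0 0).re, (F Q 0 0).im, (F Q 0 1).re, (F Q 0 1).im] a -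
      ![(F Q' 0 0).re, (F Q' 0 0).im, (F Q' 0 1).re, (F Q' 0 1).im] a) ^ 2 ≤
      hsForm 2 (F Q - F Q') (F Q - F Q') := by
    have h := sq_re_im_le_hsForm (F Q - F Q')
    simp only [Matrix.sub_apply, Complex.sub_re, Complex.sub_im] at h
    rw [Fin.sum_univ_four]
    simpa using h
  calc _ ≤ hsForm 2 (F Q - F Q') (F Q - F Q') := hcoord
    _ ≤ K * ∑ e', hsForm 2 (Q e' - Q' e') (Q e' - Q' e') := hF Q Q'
    _ = 2 * K * ∑ p, (y p - y' p) ^ 2 := by rw [hsum]; ring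


/-- **`Σ_e ‖q(y_e)‖_F² = 2 Σ_p y_p²`** for a configuration of quaternion matrices. [folklore] -/
theorem hsForm_quatConfig_sum (y : Edge 3 L × Fin 4 → ℝ) :
    ∑ e, hsForm 2 (!![((y (e, 0) : ℝ) : ℂ) + ((y (e, 1) : ℝ) : ℂ) * Complex.I,
            ((y (e, 2) : ℝ) : ℂ) + ((y (e, 3) : ℝ) : ℂ) * Complex.I;
            -((y (e, 2) : ℝ) : ℂ) + ((y (e, 3) : ℝ) : ℂ) * Complex.I,
            ((y (e, 0) : ℝ) : ℂ) - ((y (e, 1) : ℝ) : ℂ) * Complex.I] : Matrix (Fin 2) (Fin 2) ℂ)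
        (!![((y (e, 0) : ℝ) : ℂ) + ((y (e, 1) : ℝ) : ℂ) * Complex.I,
            ((y (e, 2) : ℝ) : ℂ) + ((y (e, 3) : ℝ) : ℂ) * Complex.I;
            -((y (e, 2) : ℝ) : ℂ) + ((y (e, 3) : ℝ) : ℂ) * Complex.I,
            ((y (e, 0) : ℝ) : ℂ) - ((y (e, 1) : ℝ) : ℂ) * Complex.I]) = 2 * ∑ p, y p ^ 2 := by
  rw [Fintype.sum_prod_type (fun p : Edge 3 L × Fin 4 => y p ^ 2), Finset.mul_sum]
  refine Finset.sum_congr rfl fun e _ => ?_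
  rw [hsForm_quat, Fin.sum_univ_four]

omit [NeZero L] in
/-- A configuration of quaternion matrices with continuous coordinate paths has continuous paths.
[folklore] -/
theorem continuous_quatConfig {y : Edge 3 L × Fin 4 → ℝ≥0 → ℝ} (h : ∀ p, Continuous (y p)) :
    Continuous fun t : ℝ≥0 => (fun e => (!![((y (e, 0) t : ℝ) : ℂ) + ((y (e, 1) t : ℝ) : ℂ) * Complex.I,
        ((y (e, 2) t : ℝ) : ℂ) + ((y (e, 3) t : ℝ) : ℂ) * Complex.I;
        -((y (e, 2) t : ℝ) : ℂ) + ((y (e, 3) t : ℝ) : ℂ) * Complex.I,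
        ((y (e, 0) t : ℝ) : ℂ) - ((y (e, 1) t : ℝ) : ℂ) * Complex.I] : Matrix (Fin 2) (Fin 2) ℂ) :
          MatrixConfig 3 L 2) := by
  refine continuous_pi fun e => continuous_matrix fun i j => ?_
  have h0 : Continuous (y (e, 0)) := h _
  have h1 : Continuous (y (e, 1)) := h _
  have h2 : Continuous (y (e, 2)) := h _
  have h3 : Continuous (y (e, 3)) := h _
  fin_cases i <;> fin_cases j <;>
    simp only [Matrix.of_apply, Matrix.cons_val', Matrix.cons_val_zero, Matrix.cons_val_one,
      Matrix.cons_val_fin_one, Fin.zero_eta, Fin.mk_one, Fin.isValue] <;> fun_prop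

omit [NeZero L] in
/-- Entries of a configuration of quaternion matrices with measurable coordinates are measurable
(for any σ-algebra on the sample space). [folklore] -/
theorem measurable_quatConfig {Ω : Type*} {m : MeasurableSpace Ω} {f : Edge 3 L × Fin 4 → Ω → ℝ}
    (h : ∀ p, Measurable[m] (f p)) :
    Measurable[m] fun ω => (fun e (i j : Fin 2) => (!![((f (e, 0) ω : ℝ) : ℂ) + ((f (e, 1) ω : ℝ) : ℂ) * Complex.I,
        ((f (e, 2) ω : ℝ) : ℂ) + ((f (e, 3) ω : ℝ) : ℂ) * Complex.I;
        -((f (e, 2) ω : ℝ) : ℂ) + ((f (e, 3) ω : ℝ) : ℂ) * Complex.I,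
        ((f (e, 0) ω : ℝ) : ℂ) - ((f (e, 1) ω : ℝ) : ℂ) * Complex.I] : Matrix (Fin 2) (Fin 2) ℂ) i j :
          Edge 3 L → Fin 2 → Fin 2 → ℂ) := by
  refine measurable_pi_lambda _ fun e => measurable_pi_lambda _ fun i => measurable_pi_lambda _ fun j => ?_
  have h0 : Measurable (f (e, 0)) := h _
  have h1 : Measurable (f (e, 1)) := h _
  have h2 : Measurable (f (e, 2)) := h _
  have h3 : Measurable (f (e, 3)) := h _
  fin_cases i <;> fin_cases j <;>
    simp only [Matrix.of_apply, Matrix.cons_val', Matrix.cons_val_zero, Matrix.cons_val_one,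
      Matrix.cons_val_fin_one, Fin.zero_eta, Fin.mk_one, Fin.isValue] <;> fun_prop

omit [NeZero L] in
/-- Real and imaginary parts of the entries of a configuration of quaternion matrices with progressive
coordinates are progressive. [folklore] -/
theorem isStronglyProgressive_quatConfig {Ω : Type*} {m : MeasurableSpace Ω} {𝓕 : Filtration ℝ≥0 m}
    {Y : Edge 3 L × Fin 4 → ℝ≥0 → Ω → ℝ} (h : ∀ p, IsStronglyProgressive 𝓕 (Y p)) (e : Edge 3 L) (i j : Fin 2) :
    IsStronglyProgressive 𝓕 (fun t ω => ((!![((Y (e, 0) t ω : ℝ) : ℂ) + ((Y (e, 1) t ω : ℝ) : ℂ) * Complex.I,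
        ((Y (e, 2) t ω : ℝ) : ℂ) + ((Y (e, 3) t ω : ℝ) : ℂ) * Complex.I;
        -((Y (e, 2) t ω : ℝ) : ℂ) + ((Y (e, 3) t ω : ℝ) : ℂ) * Complex.I,
        ((Y (e, 0) t ω : ℝ) : ℂ) - ((Y (e, 1) t ω : ℝ) : ℂ) * Complex.I] : Matrix (Fin 2) (Fin 2) ℂ) i j).re) ∧
      IsStronglyProgressive 𝓕 (fun t ω => ((!![((Y (e, 0) t ω : ℝ) : ℂ) + ((Y (e, 1) t ω : ℝ) : ℂ) * Complex.I,
        ((Y (e, 2) t ω : ℝ) : ℂ) + ((Y (e, 3) t ω : ℝ) : ℂ) * Complex.I;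
        -((Y (e, 2) t ω : ℝ) : ℂ) + ((Y (e, 3) t ω : ℝ) : ℂ) * Complex.I,
        ((Y (e, 0) t ω : ℝ) : ℂ) - ((Y (e, 1) t ω : ℝ) : ℂ) * Complex.I] : Matrix (Fin 2) (Fin 2) ℂ) i j).im) := by
  have hneg : ∀ p, IsStronglyProgressive 𝓕 (fun t ω => -Y p t ω) := fun p => by
    have := (isStronglyProgressive_const 𝓕 (0 : ℝ)).sub (h p)
    simpa using this
  fin_cases i <;> fin_cases j
  · simpa using ⟨h (e, 0), h (e, 1)⟩
  · simpa using ⟨h (e, 2), h (e, 3)⟩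
  · simpa using ⟨hneg (e, 2), h (e, 3)⟩
  · simpa using ⟨h (e, 0), hneg (e, 1)⟩

end Coordinates

end Summit.QuantumFields.YangMills.Theorems.ColdStartUniversality

end
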